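import Summits.Ventures.Crystal3D.Theorems.StickyWulffConstantGenericWallFloorConeCertificateRho
import Summits.Ventures.Crystal3D.Theorems.StickyWulffConstantGenericWallFloorExactOnly
import HarnessLib

/-!
# Cone certificates: PER-BALL tube radii `ρ_i` (add-on to `…ConeCertificateRho`; no new structure)

Helper for `stmt-Ventures-19480` (E1, inside-tube half).  The landed `ConeCert.eq_slots_rho` certifies ONE
radius `ρ` for all free balls — the minimum over the balls `i₀` of what the certificate directions at `i₀`
give.  But the proof only ever uses the certificate AT THE BALL OF MAXIMAL DISPLACEMENT: if every free
ball `i` is within its OWN radius `ρ_i` of its slot (`ρ_i` certified by the directions at `i` alone), then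
at `i₀ = argmax ‖x_i − s_i‖` we have `ε = ‖x_{i₀} − s_{i₀}‖ < ρ_{i₀}` and the landed contradiction runs
verbatim.  So the tube may be the PRODUCT of per-ball caps of radii `ρ_i` — for the P₅ row C12-55 the
per-ball radii of the landed multipliers are `(.074, .141, .141, .074, .141, .141, .201)` against the
uniform `.074` (tube volume in the 14-dimensional configuration space ×≈10³; lit g12 kit j295684), and
similarly for every row with unequal balls.
* `ConeCert.rhoCheckAt i₀ p q` — the landed integer ρ-inequality restricted to the directions at `i₀`;
  `rhoCheck p q` ⇒ `rhoCheckAt i₀ p q` for every `i₀` (`rhoCheckAt_of_rhoCheck`).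
* `ConeCert.eq_slots_rhoAt` / `eq_slots_rhoAt_dist` — `check ∧ (∀ i, rhoCheckAt i (p i) q)` ⇒ every
  admissible completion with ball `i` within chord `p i / q` of slot `i` IS the slot configuration.
* Finset form with slot-dependent tolerance: `SlotMatched ρ T P` (a bijection `T ≃ P` moving `t` by
  `< ρ (e t)`), `ConeCert.eq_slotSet_of_slotMatched`; and the format-agnostic E1 glue in this currency,
  `exactOnly_of_slotTube_and_exhaustion` (cf. `…ExhaustionGlue`): the B&B's tube-acceptance test becomes
  «some assignment free balls → vacant slots with ball ↦ slot `j` within `ρ_j`».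
Per-ball radii of the landed certificates: `…ConeCertRhoAt*.lean` (one `decide` per (certificate, ball)).
lit g12 (crystal3d-full; HOME/cf-lit/lean/conecert-perball/).

WHAT THIS IS NOT: the exhaustion outside the tube (eng lineage B / cf-p2 lineage A); rung F-C1 not moved.
-/

noncomputable section

namespace Summit.Ventures.Crystal3D.Theorems

open Finset Literature.Geometry.DiscreteGeometry
open scoped RealInnerProductSpace

/-- `T` is matched to `P` with SLOT-DEPENDENT tolerance `ρ`: a bijection `e : T ≃ P` with
`dist t (e t) < ρ (e t)` for every `t`.  (`EtaMatched η` is the uniform, non-strict version.) -/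
def SlotMatched (ρ : EuclideanSpace ℝ (Fin 3) → ℝ) (T P : Finset (EuclideanSpace ℝ (Fin 3))) : Prop :=
  ∃ e : ↥T ≃ ↥P, ∀ t : ↥T, dist (t : EuclideanSpace ℝ (Fin 3)) (e t : EuclideanSpace ℝ (Fin 3)) < ρ (e t)

/-- A uniform strict matching is a slot-matching with constant tolerance. -/
theorem SlotMatched.of_etaMatched {η η' : ℝ} (hη : η < η') {T P : Finset (EuclideanSpace ℝ (Fin 3))}
    (h : EtaMatched η T P) : SlotMatched (fun _ => η') T P := by
  obtain ⟨e, he⟩ := h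
  exact ⟨e, fun t => lt_of_le_of_lt (he t) hη⟩

/-- Enlarging the tolerances preserves a slot-matching. -/
theorem SlotMatched.mono {ρ ρ' : EuclideanSpace ℝ (Fin 3) → ℝ} (hρ : ∀ p, ρ p ≤ ρ' p)
    {T P : Finset (EuclideanSpace ℝ (Fin 3))} (h : SlotMatched ρ T P) : SlotMatched ρ' T P := by
  obtain ⟨e, he⟩ := h
  exact ⟨e, fun t => lt_of_lt_of_le (he t) (hρ _)⟩

namespace ConeCert

variable {m : ℕ} (C : ConeCert m)

/-- The integer ρ-check of `…ConeCertificateRho` RESTRICTED TO THE DIRECTIONS AT BALL `i₀`: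
`ρ² (N B² + 2 r² |τ|²) ≤ 8 r² |τ|²` for every `(a, b)` at `i₀`, `ρ = p/q`. -/
def rhoCheckAt (C : ConeCert m) (i₀ : Fin m) (p q : ℕ) : Bool := decide (
  0 < q ∧ 0 < p ∧
  (∀ a : Fin 2, ∀ b : Bool,
    (p : ℤ) ^ 2 * ((C.N : ℤ) * (C.B i₀ a b : ℤ) ^ 2 +
        2 * (C.r i₀ a b : ℤ) ^ 2 * dotInt (C.tau i₀ a) (C.tau i₀ a)) ≤
      8 * (C.r i₀ a b : ℤ) ^ 2 * dotInt (C.tau i₀ a) (C.tau i₀ a) * (q : ℤ) ^ 2))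

/-- The uniform check implies the per-ball check at every ball. -/
theorem rhoCheckAt_of_rhoCheck {p q : ℕ} (h : C.rhoCheck p q = true) (i₀ : Fin m) :
    C.rhoCheckAt i₀ p q = true := by
  unfold ConeCert.rhoCheck at h
  obtain ⟨hq, hp, hall⟩ := of_decide_eq_true h
  unfold ConeCert.rhoCheckAt
  exact decide_eq_true ⟨hq, hp, fun a b => hall i₀ a b⟩

/-- **Exact capping inside the PER-BALL tube.**  For a valid certificate and per-ball radii
`p i / q` passing `rhoCheckAt i (p i) q`: every admissible completion with ball `i` within chord
`p i / q` of slot `i` (for every `i`) IS the slot configuration.  Proof = the landed `eq_slots_rho` at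
the ball of maximal displacement. -/
theorem eq_slots_rhoAt (hV : C.check = true) {p : Fin m → ℕ} {q : ℕ}
    (hρ : ∀ i, C.rhoCheckAt i (p i) q = true)
    {x : Fin m → (EuclideanSpace ℝ (Fin 3))} (hx : ∀ i, ‖x i‖ = 1)
    (hxo : ∀ i, ∀ o ∈ C.ownSet, ⟪C.s i, o⟫ = 1 / 2 → ⟪x i, o⟫ ≤ 1 / 2)
    (hxx : ∀ i j, i ≠ j → ⟪C.s i, C.s j⟫ = 1 / 2 → ⟪x i, x j⟫ ≤ 1 / 2)
    (hclose : ∀ i, ‖x i - C.s i‖ < (p i : ℝ) / q) : x = C.s := by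
  classical
  have hV' := hV
  unfold ConeCert.check at hV'
  obtain ⟨hN, -, hown, hfree, htan, hcert, -⟩ := of_decide_eq_true hV'
  clear hV'
  have hsqpos := C.sqrtN_pos hN
  -- displacement, its maximum, tangent parts
  set v : Fin m → (EuclideanSpace ℝ (Fin 3)) :=
    fun i => (x i - C.s i) + (‖x i - C.s i‖ ^ 2 / 2) • C.s i with hvdef
  have hvt : ∀ i, ⟪v i, C.s i⟫ = 0 := fun i => inner_tangentPart_eq_zero (C.norm_s hV i) (hx i)
  rcases isEmpty_or_nonempty (Fin m) with hι | hι
  · funext i; exact (hι.false i).elim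
  obtain ⟨i₀, hi₀⟩ := Finite.exists_max fun i => ‖x i - C.s i‖
  set ε := ‖x i₀ - C.s i₀‖ with hεdef
  have hε0 : 0 ≤ ε := norm_nonneg _
  have hεi : ∀ i, ‖x i - C.s i‖ ≤ ε := hi₀
  -- the per-ball check AT i₀
  have hρ₀ := hρ i₀
  unfold ConeCert.rhoCheckAt at hρ₀
  obtain ⟨hrden, -, hrho⟩ := of_decide_eq_true hρ₀
  have hερ : ε < (p i₀ : ℝ) / q := hclose i₀
  have hvsq : ‖v i₀‖ ^ 2 = ε ^ 2 - ε ^ 4 / 4 := norm_tangentPart_sq (C.norm_s hV i₀) (hx i₀)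
  -- the aggregate inequality
  obtain ⟨a, b, hagg⟩ := C.aggregate hV v hvt i₀
  obtain ⟨hS0, hT0, hT1, -⟩ := htan i₀
  obtain ⟨hr, -, -, -⟩ := hcert i₀ a b
  set Ta : (EuclideanSpace ℝ (Fin 3)) := intVec (C.tau i₀ a) with hTa
  have hTpos : 0 < ‖Ta‖ := by
    have : Ta ≠ 0 := by
      rw [hTa]; fin_cases a <;> [exact intVec_ne_zero hT0; exact intVec_ne_zero hT1]
    exact norm_pos_iff.2 this
  have hna : ‖Ta‖ ^ 2 = (dotInt (C.tau i₀ a) (C.tau i₀ a) : ℝ) := by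
    rw [← real_inner_self_eq_norm_sq, hTa]; exact inner_intVec _ _
  -- second-order upper bound of the aggregate: ≤ √N (B/4) ε²
  have hownb : ∀ c : Fin C.nO,
      ⟪v (C.ownBall c), intVec (C.ownVec c)⟫ ≤ Real.sqrt C.N * (ε ^ 2 / 4) := by
    intro c
    set o : (EuclideanSpace ℝ (Fin 3)) := (Real.sqrt C.N)⁻¹ • intVec (C.ownVec c) with hodef
    have ho : o ∈ C.ownSet := Finset.mem_image_of_mem _ (Finset.mem_univ c)
    have hso : ⟪C.s (C.ownBall c), o⟫ = 1 / 2 := C.inner_s_own hN c (hown c).1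
    have heq : intVec (C.ownVec c) = Real.sqrt C.N • o := by
      rw [hodef, smul_smul, mul_inv_cancel₀ hsqpos.ne', one_smul]
    have h1 : ⟪v (C.ownBall c), o⟫ ≤ ‖x (C.ownBall c) - C.s (C.ownBall c)‖ ^ 2 / 4 :=
      inner_tangentPart_own_le hso (hxo _ o ho hso)
    have h2 : ‖x (C.ownBall c) - C.s (C.ownBall c)‖ ^ 2 ≤ ε ^ 2 :=
      pow_le_pow_left₀ (norm_nonneg _) (hεi _) 2
    rw [heq, real_inner_smul_right]
    have : ⟪v (C.ownBall c), o⟫ ≤ ε ^ 2 / 4 := by linarith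
    exact mul_le_mul_of_nonneg_left this hsqpos.le
  have hfreeb : ∀ c : Fin C.nF,
      ⟪v (C.freeA c), intVec (C.slot (C.freeB c))⟫ + ⟪v (C.freeB c), intVec (C.slot (C.freeA c))⟫ ≤
        Real.sqrt C.N * (3 / 2 * ε ^ 2) := by
    intro c
    have hss : ⟪C.s (C.freeA c), C.s (C.freeB c)⟫ = 1 / 2 := C.inner_s_s hN c (hfree c).2
    have heqA : intVec (C.slot (C.freeA c)) = Real.sqrt C.N • C.s (C.freeA c) := by
      rw [ConeCert.s, smul_smul, mul_inv_cancel₀ hsqpos.ne', one_smul]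
    have heqB : intVec (C.slot (C.freeB c)) = Real.sqrt C.N • C.s (C.freeB c) := by
      rw [ConeCert.s, smul_smul, mul_inv_cancel₀ hsqpos.ne', one_smul]
    have h1 := inner_tangentPart_free_le hss (hxx _ _ (hfree c).1 hss)
    have h2 : ‖x (C.freeA c) - C.s (C.freeA c)‖ ^ 2 ≤ ε ^ 2 :=
      pow_le_pow_left₀ (norm_nonneg _) (hεi _) 2
    have h3 : ‖x (C.freeB c) - C.s (C.freeB c)‖ ^ 2 ≤ ε ^ 2 :=
      pow_le_pow_left₀ (norm_nonneg _) (hεi _) 2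
    have h4 : ‖x (C.freeA c) - C.s (C.freeA c)‖ * ‖x (C.freeB c) - C.s (C.freeB c)‖ ≤ ε * ε :=
      mul_le_mul (hεi _) (hεi _) (norm_nonneg _) hε0
    rw [heqA, heqB, real_inner_smul_right, real_inner_smul_right,
      real_inner_comm (C.s (C.freeA c)) (v (C.freeB c)), ← mul_add]
    refine mul_le_mul_of_nonneg_left ?_ hsqpos.le
    have : ⟪v (C.freeA c), C.s (C.freeB c)⟫ + ⟪C.s (C.freeA c), v (C.freeB c)⟫ ≤
        ε * ε + (ε ^ 2 + ε ^ 2) / 4 := by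
      refine h1.trans ?_; nlinarith
    nlinarith
  have hup : (∑ c : Fin C.nO, (C.lamO i₀ a b c : ℝ) * ⟪v (C.ownBall c), intVec (C.ownVec c)⟫) +
      ∑ c : Fin C.nF, (C.lamF i₀ a b c : ℝ) *
        (⟪v (C.freeA c), intVec (C.slot (C.freeB c))⟫ +
          ⟪v (C.freeB c), intVec (C.slot (C.freeA c))⟫) ≤
      Real.sqrt C.N * ((C.B i₀ a b : ℝ) / 4) * ε ^ 2 := by
    have ho : ∑ c : Fin C.nO, (C.lamO i₀ a b c : ℝ) * ⟪v (C.ownBall c), intVec (C.ownVec c)⟫ ≤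
        ∑ c : Fin C.nO, (C.lamO i₀ a b c : ℝ) * (Real.sqrt C.N * (ε ^ 2 / 4)) :=
      Finset.sum_le_sum fun c _ => mul_le_mul_of_nonneg_left (hownb c) (by positivity)
    have hf : ∑ c : Fin C.nF, (C.lamF i₀ a b c : ℝ) *
        (⟪v (C.freeA c), intVec (C.slot (C.freeB c))⟫ +
          ⟪v (C.freeB c), intVec (C.slot (C.freeA c))⟫) ≤
        ∑ c : Fin C.nF, (C.lamF i₀ a b c : ℝ) * (Real.sqrt C.N * (3 / 2 * ε ^ 2)) :=
      Finset.sum_le_sum fun c _ => mul_le_mul_of_nonneg_left (hfreeb c) (by positivity)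
    rw [← Finset.sum_mul] at ho hf
    have hB : (C.B i₀ a b : ℝ) = (∑ c : Fin C.nO, (C.lamO i₀ a b c : ℝ)) +
        6 * ∑ c : Fin C.nF, (C.lamF i₀ a b c : ℝ) := by
      simp [ConeCert.B]
    rw [hB]
    nlinarith [ho, hf]
  -- combine: (r‖T‖/√2) ‖v i₀‖ ≤ √N (B/4) ε², square, and compare with the ρ-check at i₀
  have hεz : ε = 0 := by
    by_contra hne
    have hpos : 0 < ε := lt_of_le_of_ne hε0 (Ne.symm hne)
    have hsq2 : Real.sqrt 2 ^ 2 = 2 := Real.sq_sqrt (by norm_num)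
    have hsqN : Real.sqrt (C.N : ℝ) ^ 2 = C.N := Real.sq_sqrt (by positivity)
    have hL0 : 0 ≤ (C.r i₀ a b : ℝ) * ‖Ta‖ / Real.sqrt 2 * ‖v i₀‖ := by positivity
    have hchain : (C.r i₀ a b : ℝ) * ‖Ta‖ / Real.sqrt 2 * ‖v i₀‖ ≤
        Real.sqrt C.N * ((C.B i₀ a b : ℝ) / 4) * ε ^ 2 := hagg.trans hup
    have hsq : ((C.r i₀ a b : ℝ) * ‖Ta‖ / Real.sqrt 2 * ‖v i₀‖) ^ 2 ≤
        (Real.sqrt C.N * ((C.B i₀ a b : ℝ) / 4) * ε ^ 2) ^ 2 := pow_le_pow_left₀ hL0 hchain 2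
    have hL : ((C.r i₀ a b : ℝ) * ‖Ta‖ / Real.sqrt 2 * ‖v i₀‖) ^ 2 =
        (C.r i₀ a b : ℝ) ^ 2 * ‖Ta‖ ^ 2 / 2 * (ε ^ 2 - ε ^ 4 / 4) := by
      rw [mul_pow, div_pow, mul_pow, hsq2, hvsq]
    have hR : (Real.sqrt C.N * ((C.B i₀ a b : ℝ) / 4) * ε ^ 2) ^ 2 =
        (C.N : ℝ) * (C.B i₀ a b : ℝ) ^ 2 / 16 * ε ^ 4 := by
      rw [mul_pow, mul_pow, hsqN]; ring
    rw [hL, hR] at hsq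
    have hρr : ((p i₀ : ℝ) / q) ^ 2 * ((C.N : ℝ) * (C.B i₀ a b : ℝ) ^ 2 +
        2 * ((C.r i₀ a b : ℝ) ^ 2 * ‖Ta‖ ^ 2)) ≤ 8 * ((C.r i₀ a b : ℝ) ^ 2 * ‖Ta‖ ^ 2) := by
      have h := hrho a b
      have hden : (0 : ℝ) < q := by exact_mod_cast hrden
      have h' : (p i₀ : ℝ) ^ 2 * ((C.N : ℝ) * (C.B i₀ a b : ℝ) ^ 2 +
          2 * (C.r i₀ a b : ℝ) ^ 2 * ‖Ta‖ ^ 2) ≤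
          8 * (C.r i₀ a b : ℝ) ^ 2 * ‖Ta‖ ^ 2 * (q : ℝ) ^ 2 := by
        rw [hna]; exact_mod_cast h
      rw [div_pow]
      have hd2 : (0 : ℝ) < (q : ℝ) ^ 2 := by positivity
      calc (p i₀ : ℝ) ^ 2 / (q : ℝ) ^ 2 *
            ((C.N : ℝ) * (C.B i₀ a b : ℝ) ^ 2 + 2 * ((C.r i₀ a b : ℝ) ^ 2 * ‖Ta‖ ^ 2))
          = ((p i₀ : ℝ) ^ 2 * ((C.N : ℝ) * (C.B i₀ a b : ℝ) ^ 2 +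
              2 * (C.r i₀ a b : ℝ) ^ 2 * ‖Ta‖ ^ 2)) / (q : ℝ) ^ 2 := by ring
        _ ≤ (8 * (C.r i₀ a b : ℝ) ^ 2 * ‖Ta‖ ^ 2 * (q : ℝ) ^ 2) / (q : ℝ) ^ 2 :=
            div_le_div_of_nonneg_right h' hd2.le
        _ = 8 * ((C.r i₀ a b : ℝ) ^ 2 * ‖Ta‖ ^ 2) := by field_simp
    have hε2 : 0 < ε ^ 2 := by positivity
    have hερ2 : ε ^ 2 < ((p i₀ : ℝ) / q) ^ 2 := pow_lt_pow_left₀ hερ hε0 two_ne_zero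
    have hA2 : 0 < (C.r i₀ a b : ℝ) ^ 2 * ‖Ta‖ ^ 2 := by positivity
    have k2 : 8 * ((C.r i₀ a b : ℝ) ^ 2 * ‖Ta‖ ^ 2) ≤
        ε ^ 2 * ((C.N : ℝ) * (C.B i₀ a b : ℝ) ^ 2 + 2 * ((C.r i₀ a b : ℝ) ^ 2 * ‖Ta‖ ^ 2)) := by
      have h : ε ^ 2 * (8 * ((C.r i₀ a b : ℝ) ^ 2 * ‖Ta‖ ^ 2)) ≤
          ε ^ 2 * (ε ^ 2 * ((C.N : ℝ) * (C.B i₀ a b : ℝ) ^ 2 +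
            2 * ((C.r i₀ a b : ℝ) ^ 2 * ‖Ta‖ ^ 2))) := by
        have e : ε ^ 2 * (ε ^ 2 * ((C.N : ℝ) * (C.B i₀ a b : ℝ) ^ 2 +
            2 * ((C.r i₀ a b : ℝ) ^ 2 * ‖Ta‖ ^ 2))) =
            (C.N : ℝ) * (C.B i₀ a b : ℝ) ^ 2 * ε ^ 4 +
              2 * ((C.r i₀ a b : ℝ) ^ 2 * ‖Ta‖ ^ 2) * ε ^ 4 := by ring
        rw [e]; linarith only [hsq]
      exact le_of_mul_le_mul_left h hε2
    have hcoef : (0 : ℝ) < (C.N : ℝ) * (C.B i₀ a b : ℝ) ^ 2 + 2 * ((C.r i₀ a b : ℝ) ^ 2 * ‖Ta‖ ^ 2) := by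
      positivity
    have k3 : ε ^ 2 * ((C.N : ℝ) * (C.B i₀ a b : ℝ) ^ 2 + 2 * ((C.r i₀ a b : ℝ) ^ 2 * ‖Ta‖ ^ 2)) <
        ((p i₀ : ℝ) / q) ^ 2 * ((C.N : ℝ) * (C.B i₀ a b : ℝ) ^ 2 + 2 * ((C.r i₀ a b : ℝ) ^ 2 * ‖Ta‖ ^ 2)) :=
      mul_lt_mul_of_pos_right hερ2 hcoef
    linarith only [k2, k3, hρr]
  funext i
  have : ‖x i - C.s i‖ ≤ 0 := by rw [← hεz]; exact hεi i
  have h0 : x i - C.s i = 0 := norm_le_zero_iff.1 this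
  exact sub_eq_zero.1 h0

/-- **Distance form with per-ball radii.** -/
theorem eq_slots_rhoAt_dist (hV : C.check = true) {p : Fin m → ℕ} {q : ℕ}
    (hρ : ∀ i, C.rhoCheckAt i (p i) q = true)
    {x : Fin m → (EuclideanSpace ℝ (Fin 3))} (hx : ∀ i, ‖x i‖ = 1)
    (hxo : ∀ i, ∀ o ∈ C.ownSet, 1 ≤ dist (x i) o) (hxx : ∀ i j, i ≠ j → 1 ≤ dist (x i) (x j))
    (hclose : ∀ i, dist (x i) (C.s i) < (p i : ℝ) / q) : x = C.s :=
  C.eq_slots_rhoAt hV hρ hx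
    (fun i o ho _ => inner_le_half_of_one_le_dist (hx i) (C.norm_own hV o ho) (hxo i o ho))
    (fun i j hij _ => inner_le_half_of_one_le_dist (hx i) (hx j) (hxx i j hij))
    (fun i => by rw [← dist_eq_norm]; exact hclose i)

/-! ### Finset form with slot-dependent tolerance -/

/-- From the indexed per-ball tube statement to the finset statement: a finite set `T` of unit
vectors keeping distance `≥ 1` from the active own balls and pairwise, SLOT-MATCHED to the slot set
with tolerance `ρ` satisfying `ρ (s i) ≤ p i / q` at every slot, IS the slot set. -/
theorem eq_slotSet_of_slotMatched (hV : C.check = true) {p : Fin m → ℕ} {q : ℕ}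
    (hρ : ∀ i, C.rhoCheckAt i (p i) q = true) (hinj : ∀ i j, C.slot i = C.slot j → i = j)
    {ρ : EuclideanSpace ℝ (Fin 3) → ℝ} (hρle : ∀ i, ρ (C.s i) ≤ (p i : ℝ) / q)
    {T : Finset (EuclideanSpace ℝ (Fin 3))} (hT1 : ∀ t ∈ T, ‖t‖ = 1)
    (hTo : ∀ t ∈ T, ∀ o ∈ C.ownSet, 1 ≤ dist t o)
    (hTT : ∀ t ∈ T, ∀ t' ∈ T, t ≠ t' → 1 ≤ dist t t')
    (hm : SlotMatched ρ T (Finset.univ.image C.s)) : T = Finset.univ.image C.s := by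
  classical
  have hsinj : Function.Injective C.s := C.s_injective hV hinj
  obtain ⟨e, he⟩ := hm
  have hmem : ∀ i, C.s i ∈ Finset.univ.image C.s := fun i =>
    Finset.mem_image_of_mem _ (Finset.mem_univ i)
  set y : Fin m → ↥(Finset.univ.image C.s) := fun i => ⟨C.s i, hmem i⟩ with hy
  set x : Fin m → (EuclideanSpace ℝ (Fin 3)) :=
    fun i => ((e.symm (y i) : ↥T) : EuclideanSpace ℝ (Fin 3)) with hx
  have hxT : ∀ i, x i ∈ T := fun i => (e.symm (y i)).prop
  have hxclose : ∀ i, dist (x i) (C.s i) < (p i : ℝ) / q := by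
    intro i
    have h := he (e.symm (y i))
    rw [Equiv.apply_symm_apply] at h
    exact lt_of_lt_of_le h (hρle i)
  have hxinj : ∀ i j, i ≠ j → x i ≠ x j := by
    intro i j hij hxe
    apply hij
    have h1 : e.symm (y i) = e.symm (y j) := Subtype.ext hxe
    have h2 : y i = y j := e.symm.injective h1
    have h3 : C.s i = C.s j := by
      have := congrArg (fun z : ↥(Finset.univ.image C.s) => (z : EuclideanSpace ℝ (Fin 3))) h2
      simpa [hy] using this
    exact hsinj h3
  have hxs : x = C.s :=
    C.eq_slots_rhoAt_dist hV hρ (fun i => hT1 _ (hxT i)) (fun i o ho => hTo _ (hxT i) o ho)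
      (fun i j hij => hTT _ (hxT i) _ (hxT j) (hxinj i j hij)) hxclose
  ext t
  constructor
  · intro ht
    obtain ⟨i, -, hi⟩ := Finset.mem_image.1 (e ⟨t, ht⟩).prop
    have h1 : e ⟨t, ht⟩ = y i := Subtype.ext (by rw [hy]; exact hi.symm)
    have h2 : (⟨t, ht⟩ : ↥T) = e.symm (y i) := by rw [← h1, Equiv.symm_apply_apply]
    have h3 : t = x i := by
      have := congrArg (fun z : ↥T => (z : EuclideanSpace ℝ (Fin 3))) h2
      simpa [hx] using this
    rw [h3, hxs]; exact hmem i
  · intro ht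
    obtain ⟨i, -, rfl⟩ := Finset.mem_image.1 ht
    have : x i = C.s i := congrFun hxs i
    rw [← this]; exact hxT i

end ConeCert

/-- **E1 glue in the per-slot currency** (cf. `exactOnly_of_tube_and_exhaustion`): if (inside tube)
every twelve-point kissing completion `N ⊇ O` whose free part is SLOT-MATCHED with tolerance `ρ` to
some special completion `S ∈ specs` has free part EQUAL to `S`, and (exhaustion) every kissing
completion's free part is slot-matched to SOME `S ∈ specs`, then `O` is exact-only. -/
theorem exactOnly_of_slotTube_and_exhaustion (O : Finset (EuclideanSpace ℝ (Fin 3)))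
    (specs : Finset (Finset (EuclideanSpace ℝ (Fin 3)))) (ρ : EuclideanSpace ℝ (Fin 3) → ℝ)
    (hspec : ∀ S ∈ specs, IsClosePackedDozenAt 0 (O ∪ S))
    (htube : ∀ S ∈ specs, ∀ N : Finset (EuclideanSpace ℝ (Fin 3)), O ⊆ N → N.card = 12 →
      IsKissingAround 0 N → SlotMatched ρ (N \ O) S → N \ O = S)
    (hexh : ∀ N : Finset (EuclideanSpace ℝ (Fin 3)), O ⊆ N → N.card = 12 → IsKissingAround 0 N →
      ∃ S ∈ specs, SlotMatched ρ (N \ O) S) :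
    ExactOnly 0 O := by
  classical
  intro N hON hcard hkiss
  obtain ⟨S, hS, hmatch⟩ := hexh N hON hcard hkiss
  have hfree : N \ O = S := htube S hS N hON hcard hkiss hmatch
  have hN : N = O ∪ S := by rw [← hfree, Finset.union_sdiff_of_subset hON]
  rw [hN]
  exact hspec S hS

end Summit.Ventures.Crystal3D.Theorems

end
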